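import Summits.PneNP.PneNP.Theorems.ConvexRankGatesLinAlgGateBlindFacetGRank
import Summits.PneNP.PneNP.Theorems.ConvexRankGatesLinAlgGateBlindGRankDecoupled

/-!
# Route ConvexRankGates, crux `LinAlgGateBlind` (stmt-PneNP-10681): facet count for linear pencils, VII — the general GRANK door at `γ < 7/8`

Support theorems for the crux (vocabulary of `Theorems/ConvexRankGatesLinAlgGateBlindDefs.lean`); last file of the
facet count. The facet door `sgAt_gRank_of_facet_budget` (`…FacetGRank`, fed by the facet count `card_facets_le`)
has cover exponent `O(s · log(s · #𝒱(l)))`, so the union-bound method now reaches GENERAL `GRANK_s` gates — any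
field, any characteristic, any constants, any fan-in — up to the same range as every other door of the crux:

* `facetBudget_le_two_pow` — the facet budget in bits: `s^{2s} ∑_{j<2s} C(n+1,j) + 1 ≤ 2^{4sb+1}` when
  `s ≤ 2^Λ`, `n + 2 ≤ 2^{b+1}`, `Λ + 1 ≤ b`;
* `sgAt_gRank_logWidth_facet` — `SGAt m (IsGRankGate s) L (kOf m) (qOf m) (epsOf c m)` at the logarithmic width
  `L = (2c+8)(⌊log₂ m⌋+1)` for ALL `s` with `2s + 1 ≤ m^{7/8}/(log₂ m)^5` (was: `s² ≤ m^{7/8}/(log₂ m)^5`,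
  `sgAt_gRank_logWidth`);
* `not_computes_clique_of_isOver_gRank_logWidth_facet`, `not_computes_clique_of_isOver_perm_gRank_logWidth_facet` —
  the UNCONDITIONAL circuit lower bounds: no circuit with `≤ m^c` gates over `{∧₂, ∨₂} ∪ GRANK_s`, resp.
  `{∧₂, ∨₂} ∪ PERM_d ∪ GRANK_s` (`d log₂ d ≤ m^{7/8}/(log₂ m)^5`), computes `CLIQUE(m, ⌈m^{1/8}⌉)` in that range;
* `not_computes_clique_of_isOver_lin_rpow'` — the crux's own shape with gate parameter `⌊m^γ⌋` for EVERY real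
  `γ < 7/8` (was `γ < 7/16`, `not_computes_clique_of_isOver_lin_rpow`);
* `linAlgGateBlind_decoupled'` — the crux `LinAlgGateBlind` VERBATIM with `Lin (m^c)` replaced by `Lin ⌊m^γ⌋₊`,
  now for every `γ < 7/8`: BOTH halves of the decoupled crux sit at the union-bound limit `1 - δ = 7/8`.

The coupled crux (`Lin (m^c)` for every natural `c`) is untouched: it implies Valiant's hypothesis
(`dcPerSuperpolynomial_of_linAlgGateBlind`). Sources: the tree's facet count and doors; Razborov 1985, Alon–Boppana
1987 §3. No new definitions. [folklore]
-/

-- `Summit.PneNP.PneNP.…` duplicates `PneNP` BY DESIGN (single-problem summit).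
set_option linter.dupNamespace false

noncomputable section

namespace Summit.PneNP.PneNP.Theorems

open Finset Filter Literature.Computability.Complexity Razborov
open Summit.PneNP.PneNP.Cruxes.LinAlgGateBlind.DnfInvariantWideGatesSeeSmallCliques
open Summit.PneNP.PneNP.Cruxes.LinAlgGateBlind.DnfInvariantWideGatesSeeSmallCliques.DenseRegime

/-! ### The facet budget in bits -/

/-- **The facet budget in bits.** If `s ≤ 2^Λ`, `n + 2 ≤ 2^{b+1}` and `Λ + 1 ≤ b` then
`s^{2s} · ∑_{j<2s} C(n+1, j) + 1 ≤ 2^{4sb + 1}` (`∑_{j<2s} C(n+1,j) ≤ (n+2)^{2s}`, `s (n+2) ≤ 2^{Λ+b+1} ≤ 2^{2b}`).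
[folklore] -/
theorem facetBudget_le_two_pow {s n Λ b : ℕ} (hs : s ≤ 2 ^ Λ) (hn : n + 2 ≤ 2 ^ (b + 1)) (hΛ : Λ + 1 ≤ b) :
    s ^ (2 * s) * ∑ j ∈ range (2 * s), (n + 1).choose j + 1 ≤ 2 ^ (4 * (s * b) + 1) := by
  rcases Nat.eq_zero_or_pos s with h0 | hs1
  · subst h0
    simp
  have hsum : ∑ j ∈ range (2 * s), (n + 1).choose j ≤ (n + 2) ^ (2 * s) := by
    calc ∑ j ∈ range (2 * s), (n + 1).choose j ≤ ∑ j ∈ range (2 * s), (n + 1) ^ j :=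
          sum_le_sum fun j _ => Nat.choose_le_pow _ _
      _ = ∑ j ∈ range (2 * s - 1 + 1), (n + 1) ^ j := by rw [Nat.sub_add_cancel (by omega)]
      _ ≤ (n + 1 + 1) ^ (2 * s - 1) := sum_range_pow_le_succ_pow _ _
      _ ≤ (n + 2) ^ (2 * s) := Nat.pow_le_pow_right (by omega) (by omega)
  have hmain : s ^ (2 * s) * ∑ j ∈ range (2 * s), (n + 1).choose j ≤ 2 ^ (4 * (s * b)) := by
    calc s ^ (2 * s) * ∑ j ∈ range (2 * s), (n + 1).choose j ≤ s ^ (2 * s) * (n + 2) ^ (2 * s) :=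
          Nat.mul_le_mul_left _ hsum
      _ = (s * (n + 2)) ^ (2 * s) := (Nat.mul_pow _ _ _).symm
      _ ≤ (2 ^ Λ * 2 ^ (b + 1)) ^ (2 * s) := Nat.pow_le_pow_left (Nat.mul_le_mul hs hn) _
      _ = 2 ^ ((Λ + (b + 1)) * (2 * s)) := by rw [← pow_add, ← pow_mul]
      _ ≤ 2 ^ (4 * (s * b)) := Nat.pow_le_pow_right (by norm_num) (by nlinarith)
  have h1 : 1 ≤ 2 ^ (4 * (s * b)) := Nat.one_le_two_pow
  calc s ^ (2 * s) * ∑ j ∈ range (2 * s), (n + 1).choose j + 1 ≤ 2 ^ (4 * (s * b)) + 2 ^ (4 * (s * b)) :=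
        Nat.add_le_add hmain h1
    _ = 2 ^ (4 * (s * b) + 1) := by rw [pow_succ]; ring

/-! ### SG_GRANK at logarithmic width for all `2s + 1 ≤ m^{7/8}/(log₂ m)^5` -/

/-- **`SGAt` for GRANK gates of dimension `s` with `2s + 1 ≤ m^{7/8}/(log₂ m)^5`, over any field** (finite or not,
any characteristic, any constants, any fan-in), at the logarithmic width `L(c,m) = (2c+8)(⌊log₂ m⌋+1)`, at every
level `c`, eventually in `m`: the FACET cover `sgAt_gRank_of_facet_budget` with the budgets of `logWidth_common` at
`T = Λ·L·(4s+2)` and the cover budget `2^{4sΛL+1} · 2^{-(ν+1)} · #𝒱(L) < ε` (`facetBudget_le_two_pow`,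
`cover_budget_two_pow`, `#𝒱(L) ≤ 2^{ΛL}`). Compare `sgAt_gRank_logWidth` (live-span cover): `s² ≤ m^{7/8}/(log₂ m)^5`.
[folklore] -/
theorem sgAt_gRank_logWidth_facet : ∀ c : ℕ, ∀ᶠ m : ℕ in atTop, ∀ s : ℕ,
    2 * (s : ℝ) + 1 ≤ (m : ℝ) ^ (7 / 8 : ℝ) / Real.logb 2 m ^ 5 →
      SGAt m (IsGRankGate s) ((2 * c + 8) * (Nat.log 2 m + 1)) (kOf m) (qOf m) (epsOf c m) := by
  intro c
  filter_upwards [logWidth_common c] with m hm s hs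
  have hT : ((((Nat.log 2 m + 1) * ((2 * c + 8) * (Nat.log 2 m + 1)) * (4 * s + 2) : ℕ) : ℝ)) ≤
      16 * ((c : ℝ) + 4) * Real.logb 2 m ^ 2 * ((m : ℝ) ^ (7 / 8 : ℝ) / Real.logb 2 m ^ 5) := by
    obtain ⟨-, -, -, -, -, -, -, -, -, -, hℓ1, h5, hΛL⟩ := hm 0 (by
      push_cast
      exact mul_nonneg (mul_nonneg (by positivity) (sq_nonneg _))
        (div_nonneg (Real.rpow_nonneg (Nat.cast_nonneg m) _) (pow_nonneg (logb_two_nonneg m) 5)))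
    have h42 : (4 * (s : ℝ) + 2) ≤ 2 * ((m : ℝ) ^ (7 / 8 : ℝ) / Real.logb 2 m ^ 5) := by linarith
    push_cast
    calc ((Nat.log 2 m : ℝ) + 1) * ((2 * (c : ℝ) + 8) * ((Nat.log 2 m : ℝ) + 1)) * (4 * (s : ℝ) + 2)
        ≤ (8 * ((c : ℝ) + 4) * Real.logb 2 m ^ 2) * (2 * ((m : ℝ) ^ (7 / 8 : ℝ) / Real.logb 2 m ^ 5)) :=
          mul_le_mul hΛL h42 (by positivity) (by positivity)
      _ = 16 * ((c : ℝ) + 4) * Real.logb 2 m ^ 2 * ((m : ℝ) ^ (7 / 8 : ℝ) / Real.logb 2 m ^ 5) := by ring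
  obtain ⟨hm1, hq0, hq1, hhalf, hε, h2t, -, hpos, hB, hmΛ, hℓ1, h5, -⟩ := hm _ hT
  refine sgAt_gRank_of_facet_budget m _ (kOf m) s _ _ (qOf m) (epsOf c m) hq0 hq1 hhalf hε h2t hpos ?_
  -- the atom universe in bits
  have hV := card_smallSets_le_two_pow m ((2 * c + 8) * (Nat.log 2 m + 1))
  have hVR : (#(smallSets (Fin m) ((2 * c + 8) * (Nat.log 2 m + 1))) : ℝ) ≤
      (2 : ℝ) ^ ((Nat.log 2 m + 1) * ((2 * c + 8) * (Nat.log 2 m + 1))) := by exact_mod_cast hV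
  -- `s ≤ m ≤ 2^Λ`
  have hm1R : (1 : ℝ) ≤ m := by exact_mod_cast hm1
  have hsm : s ≤ m := by
    have hβm : (m : ℝ) ^ (7 / 8 : ℝ) / Real.logb 2 m ^ 5 ≤ m := by
      calc (m : ℝ) ^ (7 / 8 : ℝ) / Real.logb 2 m ^ 5 ≤ (m : ℝ) ^ (7 / 8 : ℝ) := by
            refine div_le_self (Real.rpow_nonneg (Nat.cast_nonneg m) _) ?_
            exact one_le_pow₀ hℓ1
        _ ≤ (m : ℝ) ^ (1 : ℝ) := Real.rpow_le_rpow_of_exponent_le hm1R (by norm_num)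
        _ = m := Real.rpow_one _
    have h0s : (0 : ℝ) ≤ s := Nat.cast_nonneg s
    have h : (s : ℝ) ≤ m := by linarith
    exact_mod_cast h
  have hs2 : s ≤ 2 ^ (Nat.log 2 m + 1) := hsm.trans hmΛ
  -- `ΛL ≥ Λ + 1`
  have hL8 : 8 ≤ (2 * c + 8) * (Nat.log 2 m + 1) :=
    (Nat.le_add_left 8 (2 * c)).trans (Nat.le_mul_of_pos_right _ (Nat.succ_pos _))
  have hP1 : Nat.log 2 m + 1 + 1 ≤ (Nat.log 2 m + 1) * ((2 * c + 8) * (Nat.log 2 m + 1)) :=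
    calc Nat.log 2 m + 1 + 1 ≤ (Nat.log 2 m + 1) * 8 := by omega
      _ ≤ (Nat.log 2 m + 1) * ((2 * c + 8) * (Nat.log 2 m + 1)) := Nat.mul_le_mul_left _ hL8
  have hN := facetBudget_le_two_pow hs2 (n := #(smallSets (Fin m) ((2 * c + 8) * (Nat.log 2 m + 1))))
    (b := (Nat.log 2 m + 1) * ((2 * c + 8) * (Nat.log 2 m + 1)))
    (by
      have h2 : 2 ≤ 2 ^ ((Nat.log 2 m + 1) * ((2 * c + 8) * (Nat.log 2 m + 1))) :=
        (Nat.pow_le_pow_right (by norm_num) (by omega) : 2 ^ 1 ≤ _)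
      rw [pow_succ]
      omega) hP1
  have hNR : (((s ^ (2 * s) * ∑ j ∈ range (2 * s),
      (#(smallSets (Fin m) ((2 * c + 8) * (Nat.log 2 m + 1))) + 1).choose j + 1 : ℕ)) : ℝ) ≤
      (2 : ℝ) ^ (4 * (s * ((Nat.log 2 m + 1) * ((2 * c + 8) * (Nat.log 2 m + 1)))) + 1) := by
    exact_mod_cast hN
  refine cover_budget_two_pow (a := 4 * (s * ((Nat.log 2 m + 1) * ((2 * c + 8) * (Nat.log 2 m + 1)))) + 1)
    (Λ := Nat.log 2 m + 1) hm1 (by positivity) hNR hVR ?_ hmΛ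
  have hring : (Nat.log 2 m + 1) * ((2 * c + 8) * (Nat.log 2 m + 1)) * (4 * s + 2) =
      4 * (s * ((Nat.log 2 m + 1) * ((2 * c + 8) * (Nat.log 2 m + 1)))) +
        2 * ((Nat.log 2 m + 1) * ((2 * c + 8) * (Nat.log 2 m + 1))) := by ring
  rw [hring] at hB
  omega

/-! ### Unconditional circuit lower bounds with general GRANK gates up to `m^{7/8 - o(1)}` -/

/-- **No polynomial-size monotone circuit with generic-rank gates of dimension `s ≤ m^{7/8-o(1)}` computes
`CLIQUE(m, ⌈m^{1/8}⌉)` (unconditional; any fields, any constants).** For every `c`, eventually in `m`, for every `s`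
with `2s + 1 ≤ m^{7/8}/(log₂ m)^5` and every circuit `C` over `{∧₂, ∨₂} ∪ GRANK_s` with `C.size ≤ m^c`:
`¬ C.Computes CLIQUE(m, ⌈m^{1/8}⌉)` — the level-`L` door theorem with the facet-cover single-gate statement
`sgAt_gRank_logWidth_facet`. [folklore] -/
theorem not_computes_clique_of_isOver_gRank_logWidth_facet : ∀ c : ℕ, ∀ᶠ m : ℕ in atTop, ∀ s : ℕ,
    2 * (s : ℝ) + 1 ≤ (m : ℝ) ^ (7 / 8 : ℝ) / Real.logb 2 m ^ 5 →
    ∀ C : Circuit (KEdge m), C.IsOver ({GateFn.and 2, GateFn.or 2} ∪ {g | IsGRankGate s g}) →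
      C.size ≤ m ^ c → ¬ C.Computes (cliqueFn m ⌈(m : ℝ) ^ (1 / 8 : ℝ)⌉₊) := by
  intro c
  filter_upwards [not_computes_clique_of_collapse_level c, sgAt_gRank_logWidth_facet c, logWidth_le_lOf c]
    with m hhost hSG hLl s hs C hC hsize
  exact hhost ((2 * c + 8) * (Nat.log 2 m + 1)) (Nat.le_mul_of_pos_right _ (Nat.succ_pos _)) hLl
    {g | IsGRankGate s g} (IsGRankGate s) (fun g (hg : IsGRankGate s g) => hg.monotone)
    (fun g (hg : IsGRankGate s g) A hA => (stub_termCollapse m s _ g A hA).2 hg) (hSG s hs) C hC hsize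

/-- **No polynomial-size monotone circuit over the crux's full wide basis `{∧₂, ∨₂} ∪ PERM_d ∪ GRANK_s` computes
`CLIQUE(m, ⌈m^{1/8}⌉)` when `d log₂ d ≤ m^{7/8}/(log₂ m)^5` and `2s + 1 ≤ m^{7/8}/(log₂ m)^5` (unconditional):** both
halves at the union-bound limit. [folklore] -/
theorem not_computes_clique_of_isOver_perm_gRank_logWidth_facet : ∀ c : ℕ, ∀ᶠ m : ℕ in atTop, ∀ d s : ℕ,
    (d : ℝ) * Real.logb 2 d ≤ (m : ℝ) ^ (7 / 8 : ℝ) / Real.logb 2 m ^ 5 →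
    2 * (s : ℝ) + 1 ≤ (m : ℝ) ^ (7 / 8 : ℝ) / Real.logb 2 m ^ 5 →
    ∀ C : Circuit (KEdge m), C.IsOver ({GateFn.and 2, GateFn.or 2} ∪ {g | IsPermGate d g ∨ IsGRankGate s g}) →
      C.size ≤ m ^ c → ¬ C.Computes (cliqueFn m ⌈(m : ℝ) ^ (1 / 8 : ℝ)⌉₊) := by
  intro c
  filter_upwards [not_computes_clique_of_collapse_level c, sgAt_perm_logWidth c, sgAt_gRank_logWidth_facet c,
    logWidth_le_lOf c] with m hhost hSGp hSGg hLl d s hd hs C hC hsize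
  refine hhost ((2 * c + 8) * (Nat.log 2 m + 1)) (Nat.le_mul_of_pos_right _ (Nat.succ_pos _)) hLl
    {g | IsPermGate d g ∨ IsGRankGate s g} (fun g => IsPermGate d g ∨ IsGRankGate s g)
    (fun g (hg : IsPermGate d g ∨ IsGRankGate s g) => hg.elim IsPermGate.monotone IsGRankGate.monotone)
    (fun g (hg : IsPermGate d g ∨ IsGRankGate s g) A hA => hg.elim
      (fun h => isTermGate_mono (fun _ h' => Or.inl h') ((stub_termCollapse m d _ g A hA).1 h))
      (fun h => isTermGate_mono (fun _ h' => Or.inr h') ((stub_termCollapse m s _ g A hA).2 h)))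
    (sgAt_or (hSGp d hd) (hSGg s hs)) C hC hsize

/-! ### The crux's own shape with a real gate exponent `γ < 7/8` -/

/-- Eventually `2⌊m^γ⌋ + 1 ≤ m^{7/8}/(log₂ m)^5` for every `γ < 7/8` (`3 (log₂ m)^5 ≤ (log₂ m)^6 ≤ m^{7/8-γ}` eventually).
[folklore] -/
theorem eventually_two_mul_floor_rpow_add_one_le {γ : ℝ} (hγ : γ < 7 / 8) :
    ∀ᶠ m : ℕ in atTop, 2 * ((⌊(m : ℝ) ^ γ⌋₊ : ℕ) : ℝ) + 1 ≤ (m : ℝ) ^ (7 / 8 : ℝ) / Real.logb 2 m ^ 5 := by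
  have hη : 0 < 7 / 8 - γ := by linarith
  filter_upwards [eventually_logb_pow_le_rpow 6 hη, eventually_logb_pow_le_rpow 5 (by norm_num : (0 : ℝ) < 7 / 8),
    eventually_ge_atTop 8] with m hlog hlog5 hm8
  have hm1 : (1 : ℝ) ≤ m := by exact_mod_cast (show 1 ≤ m by omega)
  have hmpos : (0 : ℝ) < m := by linarith
  have hℓ3 : 3 ≤ Real.logb 2 m := by
    rw [Real.le_logb_iff_rpow_le one_lt_two hmpos]
    norm_num
    exact_mod_cast hm8
  have hℓ5 : 0 < Real.logb 2 m ^ 5 := by positivity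
  have h0 : (0 : ℝ) ≤ (m : ℝ) ^ γ := Real.rpow_nonneg (Nat.cast_nonneg m) _
  have hdle : ((⌊(m : ℝ) ^ γ⌋₊ : ℕ) : ℝ) ≤ (m : ℝ) ^ γ := Nat.floor_le h0
  rw [le_div_iff₀ hℓ5]
  rcases lt_or_ge ((m : ℝ) ^ γ) 1 with hlt | hge
  · -- `⌊m^γ⌋ = 0`: the claim is `(log₂ m)^5 ≤ m^{7/8}`
    rw [Nat.floor_eq_zero.2 hlt]
    simpa using hlog5
  · -- `2⌊m^γ⌋ + 1 ≤ 3 m^γ` and `3 (log₂ m)^5 ≤ (log₂ m)^6 ≤ m^{7/8-γ}`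
    have h3 : 2 * ((⌊(m : ℝ) ^ γ⌋₊ : ℕ) : ℝ) + 1 ≤ 3 * (m : ℝ) ^ γ := by linarith
    calc (2 * ((⌊(m : ℝ) ^ γ⌋₊ : ℕ) : ℝ) + 1) * Real.logb 2 m ^ 5 ≤ 3 * (m : ℝ) ^ γ * Real.logb 2 m ^ 5 :=
          mul_le_mul_of_nonneg_right h3 hℓ5.le
      _ = (m : ℝ) ^ γ * (3 * Real.logb 2 m ^ 5) := by ring
      _ ≤ (m : ℝ) ^ γ * Real.logb 2 m ^ 6 := by
          refine mul_le_mul_of_nonneg_left ?_ h0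
          calc 3 * Real.logb 2 m ^ 5 ≤ Real.logb 2 m * Real.logb 2 m ^ 5 :=
                mul_le_mul_of_nonneg_right hℓ3 hℓ5.le
            _ = Real.logb 2 m ^ 6 := by ring
      _ ≤ (m : ℝ) ^ γ * (m : ℝ) ^ (7 / 8 - γ) := mul_le_mul_of_nonneg_left hlog h0
      _ = (m : ℝ) ^ (7 / 8 : ℝ) := by
          rw [← Real.rpow_add hmpos]
          norm_num

/-- **The crux with a real gate exponent: `{∧₂, ∨₂} ∪ PERM_{⌊m^γ⌋} ∪ GRANK_{⌊m^γ⌋}`-circuits of polynomial size are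
blind to `CLIQUE(m, ⌈m^{1/8}⌉)` for every `γ < 7/8` (unconditional).** For every `c` and every real `γ < 7/8`,
eventually in `m`, for every circuit `C` over `{∧₂, ∨₂} ∪ {g | PERM_{⌊m^γ⌋₊} g ∨ GRANK_{⌊m^γ⌋₊} g}` with `C.size ≤ m^c`:
`¬ C.Computes CLIQUE(m, ⌈m^{1/8}⌉)`. This doubles the exponent of `not_computes_clique_of_isOver_lin_rpow`
(`γ < 7/16`) and puts the GENERAL GRANK door at the union-bound limit `1 - δ = 7/8`; the crux `LinAlgGateBlind` is the
same statement with `⌊m^γ⌋` replaced by `m^c` for every natural `c`. [folklore] -/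
theorem not_computes_clique_of_isOver_lin_rpow' : ∀ (c : ℕ) (γ : ℝ), γ < 7 / 8 → ∀ᶠ m : ℕ in atTop,
    ∀ C : Circuit (KEdge m),
      C.IsOver ({GateFn.and 2, GateFn.or 2} ∪
        {g | IsPermGate ⌊(m : ℝ) ^ γ⌋₊ g ∨ IsGRankGate ⌊(m : ℝ) ^ γ⌋₊ g}) →
      C.size ≤ m ^ c → ¬ C.Computes (cliqueFn m ⌈(m : ℝ) ^ (1 / 8 : ℝ)⌉₊) := by
  intro c γ hγ
  filter_upwards [not_computes_clique_of_isOver_perm_gRank_logWidth_facet c, eventually_floor_rpow_mul_logb_le hγ,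
    eventually_two_mul_floor_rpow_add_one_le hγ] with m hm hd hs C hC hsize
  exact hm _ _ hd hs C hC hsize

/-! ### The decoupled crux for every `γ < 7/8`, in the crux's own words -/

open scoped Classical in
/-- **The decoupled crux at the union-bound limit, proved.** The statement of the crux
`Summit.PneNP.PneNP.Theses.ConvexRankGates.LinAlgGateBlind` VERBATIM (same inline gate classes `Lin`, same inline
clique function, same quantifier shape), except that the gate parameter `Lin (m ^ c)` is replaced by `Lin ⌊m^γ⌋₊` for a
real exponent `γ < 7/8` quantified next to `c`: there is `δ ∈ (0, 1/2)` (namely `δ = 1/8`) such that for every `c` and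
every `γ < 7/8`, eventually in `m`, no circuit with `≤ m^c` gates over `{∧₂, ∨₂} ∪ PERM_{⌊m^γ⌋} ∪ GRANK_{⌊m^γ⌋}` computes
`CLIQUE(m, ⌈m^δ⌉)`. Unconditional (`not_computes_clique_of_isOver_lin_rpow'`, through the facet count for linear
pencils); it supersedes `linAlgGateBlind_decoupled` (`γ < 7/16`). The coupled crux (`Lin (m^c)` for every natural `c`)
implies Valiant's hypothesis (`dcPerSuperpolynomial_of_linAlgGateBlind`) and is out of reach of every union-bound
cover. [folklore] -/
theorem linAlgGateBlind_decoupled' :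
    let Lin : ℕ → Set Literature.Computability.Complexity.GateFn := fun s => {g | (∃ d : ℕ, d ≤ s ∧ ∃ (σ : Fin g.1 → Equiv.Perm (Fin d)) (τ : Equiv.Perm (Fin d)), ∀ v : Fin g.1 → Bool, g.2 v = true ↔ τ ∈ Subgroup.closure (σ '' {i | v i = true})) ∨ (∃ (F : Type) (_ : Field F) (d θ : ℕ), d ≤ s ∧ ∃ (K₀ : Matrix (Fin d) (Fin d) F) (K : Fin g.1 → Matrix (Fin d) (Fin d) F), ∀ v : Fin g.1 → Bool, g.2 v = true ↔ θ ≤ (K₀.map (algebraMap F (FractionRing (MvPolynomial (Fin g.1) F))) + ∑ i, if v i then (algebraMap (MvPolynomial (Fin g.1) F) (FractionRing (MvPolynomial (Fin g.1) F)) (MvPolynomial.X i)) • (K i).map (algebraMap F (FractionRing (MvPolynomial (Fin g.1) F))) else 0).rank)};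
    ∃ δ : ℝ, 0 < δ ∧ δ < 1 / 2 ∧ ∀ (c : ℕ) (γ : ℝ), γ < 7 / 8 → ∀ᶠ m : ℕ in atTop,
      ∀ C : Literature.Computability.Complexity.Circuit ((⊤ : SimpleGraph (Fin m)).edgeSet),
        C.IsOver ({Literature.Computability.Complexity.GateFn.and 2, Literature.Computability.Complexity.GateFn.or 2} ∪
          Lin ⌊(m : ℝ) ^ γ⌋₊) → C.size ≤ m ^ c →
        ¬ C.Computes (fun x => decide (¬ (SimpleGraph.fromEdgeSet {e : Sym2 (Fin m) |
          ∃ h : e ∈ (⊤ : SimpleGraph (Fin m)).edgeSet, x ⟨e, h⟩ = true}).CliqueFree ⌈(m : ℝ) ^ δ⌉₊)) := by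
  intro Lin
  refine ⟨1 / 8, by norm_num, by norm_num, fun c γ hγ => ?_⟩
  exact not_computes_clique_of_isOver_lin_rpow' c γ hγ

end Summit.PneNP.PneNP.Theorems

end
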